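import Summits.AtomisticToContinuum.Crystallization.Theorems.PalmUnimodularRigidityLayeredLawsSelectHcpCertificateDefsC
import Summits.AtomisticToContinuum.Crystallization.Theorems.PalmUnimodularRigidityLayeredLawsSelectHcpIntegralCountRestrict
import Summits.AtomisticToContinuum.Crystallization.Theorems.PalmUnimodularRigidityLayeredLawsSelectHcpLocalChartIff

/-!
# Crux `LayeredLawsSelectHcp` (stmt-AtomisticToContinuum-9226), line `mtp-prestress-split-ergodic-frame`:
# the iterated Campbell integral of the chart weight against `count|S` is the finite chart sum

Registered sub-goal `tube_iterInt_count_eq_chartSum` of the crux item (lead c2, cycle 3; the measurable surrogate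
of the corrector transport function, `CertificateDefsC`).  For a rooted hcp-charted tube configuration `S ∋ 0` with
good shells and a kernel `κ` acting as the identity on `count|S`, the iterated Bochner integral of the chart weight
`chartWeight e ψ y` along the list of the 57 near-ball labels, started at the zero tuple, evaluates to the finite sum
`∑ᶠ_{X rooted chart of S, X e = −y} ψ (X|nearBall)`:

* `IterIntCount.iterInt_count_eq_finsum` — FUBINI FOR COUNTING MEASURES, by induction along a duplicate-free label
  list `L`: if the `S`-valued extensions `w` of the tuple `z` along `L` (`w u ∈ S` for `u ∈ L`, `w u = z u` off `L`)
  on which `H ≠ 0` form a finite set, then `iterInt κ L H (count|S) z = ∑ᶠ_{w extension} H w`.  The cons step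
  integrates the (finitely supported, hence measurable, `IterIntCount.measurable_of_finite_support`) partial sums
  against `count|S` by `tube_integral_count_restrict_of_finite_support` (the integrand is corrected off `S`, a
  `count|S`-null set, where the induction hypothesis is not available) and re-assembles the double sum fibrewise over
  the value at the new label (`Finset.sum_fiberwise_of_maps_to`);
* for `H = chartWeight e ψ y`, `L = nearBall.toList`, `z = 0` the extensions in the support are local chart PATTERNS
  with near-ball values in `S`, i.e. local charts (`isLocalChart_iff_pattern`), i.e. — `tube_localChart_iff` — the
  near-ball restrictions (extended by `0`) of the finitely many (`tube_rootedCharts_ncard`) rooted charts; the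
  restriction map is a bijection onto them (`tube_rootedChart_unique`: the star labels lie in the near ball), and on
  the restriction of `X` the chart weight reads `ψ (X|nearBall)` (`finsum_mem_eq_of_bijOn`).

All `[folklore]`.
-/

noncomputable section

namespace Summit.AtomisticToContinuum.Crystallization.Theorems.PalmUnimodularRigidity.LayeredLawsSelectHcp

open MeasureTheory Set ProbabilityTheory
open Literature.MathematicalPhysics.StatisticalMechanics Literature.Geometry.DiscreteGeometry
open Summit.AtomisticToContinuum.Crystallization.Theorems.LayeredLawsSelectHcp.Negative.DiracLaws (GoodShell)

namespace IterIntCount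

/-! ## Fubini for counting measures along a label list -/

/-- A real function on `ℝ³` with finite support is measurable. [folklore] -/
theorem measurable_of_finite_support {f : EuclideanSpace ℝ (Fin 3) → ℝ} (hf : (Function.support f).Finite) :
    Measurable f :=
  (measurable_const (a := (0 : ℝ))).measurable_of_countable_ne (hf.countable.mono fun _ hx => Ne.symm hx)

/-- **Fubini for counting measures along a duplicate-free label list.**  If `κ μ = count|S` (`S` measurable) and
the `S`-valued extensions of `z` along `L` on which `H ≠ 0` form a finite set, then the iterated integral
`iterInt κ L H μ z` is the sum of `H` over all `S`-valued extensions of `z` along `L`. [folklore] -/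
theorem iterInt_count_eq_finsum {S : Set (EuclideanSpace ℝ (Fin 3))} (hS : MeasurableSet S)
    (κ : Kernel (Measure (EuclideanSpace ℝ (Fin 3))) (EuclideanSpace ℝ (Fin 3)))
    (μ : Measure (EuclideanSpace ℝ (Fin 3)))
    (hκ : κ μ = (Measure.count : Measure (EuclideanSpace ℝ (Fin 3))).restrict S)
    (H : (ℤ × ℤ × ℤ → EuclideanSpace ℝ (Fin 3)) → ℝ) :
    ∀ L : List (ℤ × ℤ × ℤ), L.Nodup → ∀ z : ℤ × ℤ × ℤ → EuclideanSpace ℝ (Fin 3),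
      ({w | (∀ v ∈ L, w v ∈ S) ∧ ∀ v, v ∉ L → w v = z v} ∩ Function.support H).Finite →
      iterInt κ L H μ z = ∑ᶠ w ∈ {w | (∀ v ∈ L, w v ∈ S) ∧ ∀ v, v ∉ L → w v = z v}, H w := by
  intro L
  induction L with
  | nil =>
    intro _ z _
    have hset : {w : ℤ × ℤ × ℤ → EuclideanSpace ℝ (Fin 3) |
        (∀ v ∈ ([] : List (ℤ × ℤ × ℤ)), w v ∈ S) ∧ ∀ v, v ∉ ([] : List (ℤ × ℤ × ℤ)) → w v = z v} = {z} := by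
      ext w
      simp only [List.not_mem_nil, false_imp_iff, imp_true_iff, not_false_eq_true, true_imp_iff, true_and,
        mem_setOf_eq, mem_singleton_iff, funext_iff]
    rw [iterInt_nil, hset, finsum_mem_singleton]
  | cons u L ih =>
    intro hnd z hfin
    classical
    obtain ⟨huL, hL⟩ := List.nodup_cons.1 hnd
    -- the `S`-valued extensions of `z` along `u :: L`
    set E : Set (ℤ × ℤ × ℤ → EuclideanSpace ℝ (Fin 3)) :=
      {w | (∀ v ∈ u :: L, w v ∈ S) ∧ ∀ v, v ∉ u :: L → w v = z v}
    -- the partial sums after integrating out the labels of `L`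
    obtain ⟨G, hG⟩ : ∃ G : EuclideanSpace ℝ (Fin 3) → ℝ, ∀ x, G x =
        ∑ᶠ w ∈ {w | (∀ v ∈ L, w v ∈ S) ∧ ∀ v, v ∉ L → w v = Function.update z u x v}, H w :=
      ⟨_, fun _ => rfl⟩
    -- fibres over the value at `u`
    have hsub : ∀ x ∈ S, ∀ w, ((∀ v ∈ L, w v ∈ S) ∧ ∀ v, v ∉ L → w v = Function.update z u x v) →
        w ∈ E ∧ w u = x := fun x hx w hw => by
      have hwu : w u = x := by rw [hw.2 u huL, Function.update_self]
      refine ⟨⟨fun v hv => ?_, fun v hv => ?_⟩, hwu⟩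
      · rcases List.mem_cons.1 hv with rfl | hv
        · rwa [hwu]
        · exact hw.1 v hv
      · have hvu : v ≠ u := fun h => hv (h ▸ List.mem_cons_self)
        rw [hw.2 v fun h => hv (List.mem_cons_of_mem u h), Function.update_of_ne hvu]
    have hsup : ∀ w ∈ E, ∀ x, w u = x →
        (∀ v ∈ L, w v ∈ S) ∧ ∀ v, v ∉ L → w v = Function.update z u x v := fun w hw x hwu => by
      refine ⟨fun v hv => hw.1 v (List.mem_cons_of_mem u hv), fun v hv => ?_⟩
      by_cases hvu : v = u
      · subst hvu
        rw [Function.update_self, hwu]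
      · rw [Function.update_of_ne hvu]
        exact hw.2 v fun h => (List.mem_cons.1 h).elim hvu hv
    -- the induction hypothesis on `S`
    have hIH : ∀ x ∈ S, iterInt κ L H μ (Function.update z u x) = G x := fun x hx => by
      rw [hG]
      refine ih hL _ (hfin.subset ?_)
      rintro w ⟨hw, hwH⟩
      exact ⟨(hsub x hx w hw).1, hwH⟩
    -- the support of the partial sums on `S` lies in the finite set of values at `u`
    have hGsupp : ∀ x ∈ S, G x ≠ 0 → x ∈ (hfin.toFinset.image fun w => w u) := fun x hx hGx => by
      rw [hG] at hGx
      obtain ⟨w, hw, hwH⟩ := exists_ne_zero_of_finsum_mem_ne_zero hGx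
      obtain ⟨hwE, hwu⟩ := hsub x hx w hw
      exact Finset.mem_image.2 ⟨w, hfin.mem_toFinset.2 ⟨hwE, hwH⟩, hwu⟩
    have himS : ∀ x ∈ (hfin.toFinset.image fun w => w u), x ∈ S := fun x hx => by
      obtain ⟨w, hw, rfl⟩ := Finset.mem_image.1 hx
      exact ((hfin.mem_toFinset.1 hw).1).1 u List.mem_cons_self
    -- Step 1: the integrand agrees `count|S`-a.e. with the corrected partial sums `S.indicator G`
    have hmeas : Measurable (S.indicator G) := by
      refine measurable_of_finite_support ((hfin.toFinset.image fun w => w u).finite_toSet.subset ?_)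
      intro x hx
      rw [Function.mem_support] at hx
      have hxS : x ∈ S := by
        by_contra h
        exact hx (indicator_of_notMem h G)
      rw [indicator_of_mem hxS] at hx
      exact hGsupp x hxS hx
    have hfinG : (S ∩ Function.support (S.indicator G)).Finite := by
      refine ((hfin.toFinset.image fun w => w u).finite_toSet.subset ?_)
      rintro x ⟨hxS, hx⟩
      rw [Function.mem_support, indicator_of_mem hxS] at hx
      exact hGsupp x hxS hx
    rw [iterInt_cons, hκ]
    calc ∫ x, iterInt κ L H μ (Function.update z u x)
          ∂((Measure.count : Measure (EuclideanSpace ℝ (Fin 3))).restrict S)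
        = ∫ x, S.indicator G x ∂((Measure.count : Measure (EuclideanSpace ℝ (Fin 3))).restrict S) := by
          refine integral_congr_ae ((ae_restrict_mem hS).mono fun x hx => ?_)
          beta_reduce
          rw [hIH x hx, indicator_of_mem hx]
      _ = ∑ᶠ x ∈ S, S.indicator G x := tube_integral_count_restrict_of_finite_support S _ hmeas hfinG
      _ = ∑ᶠ x ∈ S, G x := finsum_mem_congr rfl fun x hx => indicator_of_mem hx G
      _ = ∑ x ∈ hfin.toFinset.image (fun w => w u), G x := by
          refine finsum_mem_eq_sum_of_subset G ?_ fun x hx => himS x hx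
          rintro x ⟨hxS, hx⟩
          exact hGsupp x hxS hx
      _ = ∑ x ∈ hfin.toFinset.image (fun w => w u), ∑ w ∈ hfin.toFinset with w u = x, H w := by
          refine Finset.sum_congr rfl fun x hx => ?_
          rw [hG]
          refine finsum_mem_eq_sum_of_subset H ?_ ?_
          · rintro w ⟨hw, hwH⟩
            obtain ⟨hwE, hwu⟩ := hsub x (himS x hx) w hw
            exact Finset.mem_filter.2 ⟨hfin.mem_toFinset.2 ⟨hwE, hwH⟩, hwu⟩
          · intro w hw
            obtain ⟨hwT, hwu⟩ := Finset.mem_filter.1 hw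
            exact hsup w (hfin.mem_toFinset.1 hwT).1 x hwu
      _ = ∑ w ∈ hfin.toFinset, H w :=
          Finset.sum_fiberwise_of_maps_to (fun w hw => Finset.mem_image_of_mem (fun w => w u) hw) H
      _ = ∑ᶠ w ∈ E, H w := by
          refine (finsum_mem_eq_sum_of_subset H ?_ ?_).symm
          · rw [hfin.coe_toFinset]
          · rw [hfin.coe_toFinset]
            exact inter_subset_left


end IterIntCount

/-! ## The chart sum -/

/-- **Registered sub-goal `tube_iterInt_count_eq_chartSum` — the iterated Campbell integral of the chart weight against
a counting measure is the chart sum.**  For an hcp-charted `S ∋ 0` with good shells and a kernel `κ` with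
`κ (count|S) = count|S`, the iterated integral of `chartWeight e ψ y` (`e` a near-ball label) along `nearBall.toList`
from the zero tuple equals `∑ᶠ_{X rooted chart of S, X e = −y} ψ (X|nearBall)`: by `IterIntCount.iterInt_count_eq_finsum`
it is the sum of the chart weight over the `S`-valued near-ball tuples, whose members in the support are local charts
(`isLocalChart_iff_pattern`), i.e. (`tube_localChart_iff`) the zero-extended near-ball restrictions of the finitely
many rooted charts (`tube_rootedCharts_ncard`), in bijection with them (`tube_rootedChart_unique`). [folklore] -/
theorem tube_iterInt_count_eq_chartSum : ∀ S : Set (EuclideanSpace ℝ (Fin 3)), (0 : EuclideanSpace ℝ (Fin 3)) ∈ S → (∀ x ∈ S, GoodShell S x) → HcpCharted S → ∀ (κ : ProbabilityTheory.Kernel (MeasureTheory.Measure (EuclideanSpace ℝ (Fin 3))) (EuclideanSpace ℝ (Fin 3))), κ ((MeasureTheory.Measure.count : MeasureTheory.Measure (EuclideanSpace ℝ (Fin 3))).restrict S) = (MeasureTheory.Measure.count : MeasureTheory.Measure (EuclideanSpace ℝ (Fin 3))).restrict S → ∀ (e : ℤ × ℤ × ℤ), e ∈ nearBall → ∀ (ψ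 : (↥nearBall → EuclideanSpace ℝ (Fin 3)) → ℝ) (y : EuclideanSpace ℝ (Fin 3)), iterInt κ nearBall.toList (chartWeight e ψ y) ((MeasureTheory.Measure.count : MeasureTheory.Measure (EuclideanSpace ℝ (Fin 3))).restrict S) 0 = ∑ᶠ X ∈ {X : ℤ × ℤ × ℤ → EuclideanSpace ℝ (Fin 3) | IsRootedChart S X ∧ X e = -y}, ψ (fun u => X u) := by
  intro S h0 hgood hchart κ hκ e he ψ y
  classical
  -- the local-chart dictionary: local charts are the near-ball restrictions of the rooted charts
  have hloc := tube_localChart_iff S h0 hgood hchart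
  -- `S` is countable (the image of a chart), hence measurable
  obtain ⟨X₀, -, -, hSX₀, -⟩ := tube_exists_rootedChart S h0 hchart
  have hSm : MeasurableSet S :=
    ((Set.countable_range X₀).mono fun x hx => by
      obtain ⟨u, hu⟩ := hSX₀ x hx
      exact ⟨u, hu⟩).measurableSet
  -- the rooted charts form a finite set
  have hfinR : {X : ℤ × ℤ × ℤ → EuclideanSpace ℝ (Fin 3) | IsRootedChart S X}.Finite := by
    rw [← rootedCharts_count_restrict]
    exact (tube_rootedCharts_ncard S h0 hgood hchart).1
  -- the `S`-valued extensions of `0` along `nearBall.toList`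
  set E : Set (ℤ × ℤ × ℤ → EuclideanSpace ℝ (Fin 3)) :=
    {w | (∀ v ∈ nearBall.toList, w v ∈ S) ∧
      ∀ v, v ∉ nearBall.toList → w v = (0 : ℤ × ℤ × ℤ → EuclideanSpace ℝ (Fin 3)) v}
  -- near-ball restrictions of rooted charts, extended by zero
  have hres_mem : ∀ X, IsRootedChart S X → (↑nearBall : Set (ℤ × ℤ × ℤ)).indicator X ∈ E := fun X hX =>
    ⟨fun v hv => by
      rw [indicator_of_mem (Finset.mem_coe.2 (Finset.mem_toList.1 hv))]
      exact hX.2.1 v,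
     fun v hv => by
      rw [indicator_of_notMem (fun h => hv (Finset.mem_toList.2 (Finset.mem_coe.1 h))), Pi.zero_apply]⟩
  have hres_loc : ∀ X, IsRootedChart S X → IsLocalChart S ((↑nearBall : Set (ℤ × ℤ × ℤ)).indicator X) :=
    fun X hX => (hloc _).2 ⟨X, hX, fun u hu => indicator_of_mem (Finset.mem_coe.2 hu) X⟩
  -- an extension which is a local chart pattern is the restriction of a rooted chart
  have hpat : ∀ w ∈ E, IsLocalChartPattern w →
      ∃ X, IsRootedChart S X ∧ (∀ u ∈ nearBall, w u = X u) ∧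
        (↑nearBall : Set (ℤ × ℤ × ℤ)).indicator X = w := fun w hw hp => by
    obtain ⟨X, hX, hwX⟩ := (hloc w).1 ((isLocalChart_iff_pattern S w).2
      ⟨hp, fun u hu => hw.1 u (Finset.mem_toList.2 hu)⟩)
    refine ⟨X, hX, hwX, funext fun u => ?_⟩
    by_cases hu : u ∈ nearBall
    · rw [indicator_of_mem (Finset.mem_coe.2 hu), hwX u hu]
    · rw [indicator_of_notMem (fun h => hu (Finset.mem_coe.1 h)), hw.2 u (fun h => hu (Finset.mem_toList.1 h)),
        Pi.zero_apply]
  -- off the local chart patterns with `w e = -y` the chart weight vanishes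
  have hcw : ∀ w, chartWeight e ψ y w ≠ 0 → IsLocalChartPattern w ∧ w e = -y := fun w hw => by
    by_contra h
    exact hw (by rw [chartWeight, if_neg h])
  -- finiteness of the support among the extensions
  have hfin : (E ∩ Function.support (chartWeight e ψ y)).Finite := by
    refine (hfinR.image fun X => (↑nearBall : Set (ℤ × ℤ × ℤ)).indicator X).subset ?_
    rintro w ⟨hw, hwH⟩
    obtain ⟨X, hX, -, hXw⟩ := hpat w hw (hcw w hwH).1
    exact ⟨X, hX, hXw⟩
  rw [IterIntCount.iterInt_count_eq_finsum hSm κ _ hκ (chartWeight e ψ y) nearBall.toList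
    (Finset.nodup_toList _) 0 hfin]
  rw [finsum_mem_inter_support_eq (chartWeight e ψ y) E (E ∩ {w | IsLocalChartPattern w ∧ w e = -y})
    (Set.ext fun w => ⟨fun ⟨hw, hwH⟩ => ⟨⟨hw, hcw w hwH⟩, hwH⟩, fun ⟨⟨hw, _⟩, hwH⟩ => ⟨hw, hwH⟩⟩)]
  symm
  refine finsum_mem_eq_of_bijOn (↑nearBall : Set (ℤ × ℤ × ℤ)).indicator ⟨?_, ?_, ?_⟩ ?_
  · -- maps to
    rintro X ⟨hX, hXe⟩
    refine ⟨hres_mem X hX, ((isLocalChart_iff_pattern S _).1 (hres_loc X hX)).1, ?_⟩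
    rw [indicator_of_mem (Finset.mem_coe.2 he), hXe]
  · -- injective: two rooted charts agreeing on the near ball agree on the star, hence are equal
    rintro X ⟨hX, -⟩ X' ⟨hX', -⟩ hXX'
    refine tube_rootedChart_unique S X X' hgood hX hX' fun v hv => ?_
    have h := congrFun hXX' v
    rwa [indicator_of_mem (Finset.mem_coe.2 (LocalChartIff.mem_nearBall_of_mem_hcpStarIdx hv)),
      indicator_of_mem (Finset.mem_coe.2 (LocalChartIff.mem_nearBall_of_mem_hcpStarIdx hv))] at h
  · -- onto
    rintro w ⟨hw, hp, hwe⟩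
    obtain ⟨X, hX, hwX, hXw⟩ := hpat w hw hp
    exact ⟨X, ⟨hX, by rw [← hwX e he, hwe]⟩, hXw⟩
  · -- values
    rintro X ⟨hX, hXe⟩
    have hc : IsLocalChartPattern ((↑nearBall : Set (ℤ × ℤ × ℤ)).indicator X) ∧
        (↑nearBall : Set (ℤ × ℤ × ℤ)).indicator X e = -y :=
      ⟨((isLocalChart_iff_pattern S _).1 (hres_loc X hX)).1, by rw [indicator_of_mem (Finset.mem_coe.2 he), hXe]⟩
    rw [chartWeight, if_pos hc]
    congr 1
    funext u
    exact (indicator_of_mem (Finset.mem_coe.2 u.2) X).symm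

end Summit.AtomisticToContinuum.Crystallization.Theorems.PalmUnimodularRigidity.LayeredLawsSelectHcp

end
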